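import Mathlib.Probability.Independence.Basic
import Mathlib.MeasureTheory.Function.ConditionalExpectation.Basic
import Mathlib.MeasureTheory.Function.LpSeminorm.Basic
import Mathlib.Topology.EMetricSpace.BoundedVariation
import Literature.Probability.Percolation.QuadCrossingSpace
import HarnessLib

/-!
# The factorization theorem and the black-noise property of percolation scaling limits (Schramm–Smirnov 2011, Thm. 1.7 and Cor. 1.8)

Topic `Literature/Probability/Percolation`; cite item `wi-18717` (route
`Summits/CriticalPhenomena/CardyFormulaZ2/Theses/CardyBlackNoise`, item `OverlayUpgrade`), on top of
the tree's Schramm–Smirnov space `QuadConfig D = ℋ_D` (`QuadCrossingSpace.lean`: quads `Quad D`,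
crossing events `⊞_Q = QuadConfig.crossedEvent Q`, the laws `squareCrossingLaw D δ` of critical
bond percolation on `δℤ²`, subsequential limits `IsSubseqQuadLimit D μ`).

## Sources, read verbatim

* O. Schramm, S. Smirnov, *On the scaling limits of planar percolation*, Ann. Probab. 39 (2011)
  [SchrammSmirnov2011], arXiv:1101.5820 p. 11: "By Theorem 1.4, the Borel `σ`-field of `ℋ_D` is
  `σ(⊞_Q, Q ∈ 𝒬_D)`, that is, generated by the crossing events inside `D`.  Let
  `𝓕_D := σ(⊞_Q, Q ∈ 𝒬_D)` also denote the corresponding subfield of the Borel `σ`-field of `ℋ_ℂ`.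
  **Theorem 1.7 (Factorization).**  Consider a collection of percolation models, satisfying
  Assumptions 1.1 [bond percolation on `ℤ²` is one, p. 7].  Let `D` be a domain, and let `α ⊂ ℂ`
  be a finite union of finite length paths with finitely many double points.  Denote the
  components of `D ∖ α` by `D_j`.  Then for any subsequential scaling limit
  `𝓕_D = 𝓕_{D∖α} = ∨_j 𝓕_{D_j}`, up to sets of measure zero."  — "Fix a subsequential scaling
  limit of the critical percolation for the bond model on the square lattice or for the site
  model on the triangular lattice.  By the results above for a domain `D`, it is described by a
  probability space `(ℋ_D, 𝓕_D, μ_D)` … Then in the language of Tsirelson (see [Ts04],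
  Definition 3d1) it is a noise or a homogeneous continuous product of probability spaces with a
  Boolean base given by an appropriate algebra of piecewise-smooth planar domains (e.g.,
  generated by rectangles). … purely nonclassical noises are called "black" by Tsirelson. …
  **Corollary 1.8 (Percolation is a noise).**  Thus, we conclude that, in the language of
  Tsirelson, any subsequential scaling limit as above is a noise with a Boolean base given by an
  appropriate algebra of piecewise-smooth planar domains (e.g., generated by rectangles).
  Therefore, it has to be a black noise, as explained in [Ts03], Remark 8a2."
* B. Tsirelson, *Noise as a Boolean algebra of `σ`-fields*, Ann. Probab. 42 (2014)
  [Tsirelson2014], arXiv:1111.7270 §1.1: Def. 1.1 "A noise-type Boolean algebra is a distributive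
  sublattice `B ⊂ Λ` [of sub-`σ`-fields containing all null sets] such that `0_Λ ∈ B`,
  `1_Λ ∈ B`, all elements of `B` are complemented (in `B`), and for every `x ∈ B` the `σ`-fields
  `x, x'` are independent"; Def. 1.2 "The first chaos space `H⁽¹⁾(B)` is [the] subspace of
  `H = L₂(Ω, 𝓕, P)` consisting of all `f ∈ H` such that `f = E(f|x) + E(f|x')` for all `x ∈ B`";
  Def. 1.3 "(b) `B` is called black if the first chaos space contains only `0` (but
  `0_Λ ≠ 1_Λ`)"; §1.6: "a measure factorization over a Boolean algebra `𝒜` is a map `φ : 𝒜 → Λ`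
  such that `φ(a₁ ∧ a₂) = φ(a₁) ∧ φ(a₂)`, `φ(a₁ ∨ a₂) = φ(a₁) ∨ φ(a₂)`, `φ(0) = 0`, `φ(1) = 1`, and
  two `σ`-fields `φ(a)`, `φ(a')` are independent … the image `B = φ(𝒜) ⊂ Λ` evidently is a
  noise-type Boolean algebra"; "For the noise of percolation we know that the noise over `ℝ²` is
  black".
* B. Tsirelson, *Scaling limit, noise, stability* (Saint-Flour 2002) [Tsirelson2003],
  arXiv:math/0301237, §6.4 "Black noise", Definition 107 of the arXiv numbering (= Def. 6d1):
  "A noise is black if its stable `σ`-field is degenerate. In other words: its first chaos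
  contains only `0`", §6.5, Lemma 115 (`𝐇₁(f) = ‖Q₁ f‖`, `Q₁` the projection onto the first
  chaos, `𝐇₁(f) = lim Σ_k Var(E(f | 𝓕_{t_{k-1},t_k}))` over finite partitions ordered by
  inclusion), and §8.1, Remark 137 (the remark SS11 cite as "Remark 8a2"): "the two-dimensional
  noise of percolation … should appear to be a (two-dimensional) black noise, due to … the
  critical exponent for a small cell of size `ε × ε` being pivotal … `O(ε^{5/4})`, therefore
  `o(ε)`".

## Contents (namespace `Literature.Probability.Percolation.QuadCrossing`)

Real definitions:
* `crossingField U` — `𝓕_U := σ(⊞_Q : [Q] ⊆ U)`, the sub-`σ`-algebra of the Borel `σ`-algebra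
  of `ℋ_D` generated by the crossing events of the quads inside `U ⊆ ℂ` (`crossingField_le`);
* `AEIncluded μ m₁ m₂` — "`m₁ ⊆ m₂` up to sets of `μ`-measure zero": every `m₁`-measurable set
  is `μ`-a.e. equal to an `m₂`-measurable set (`refl`, `trans`, `of_le`);
* `IsFiniteLengthPathUnion α` — `α` is a finite union of finite-length (bounded-variation) paths
  `[0,1] → ℂ` with finitely many double points;
* `rectAlgebra` — the Boolean base "generated by rectangles": the Boolean algebra of subsets of
  `ℂ` generated by the coordinate half-planes (`halfPlanes`; Mathlib `generateSetAlgebra`), an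
  element `W` indexing the planar domain `interior (D ∩ W)` of `D` and its `σ`-field
  `regionField D W := 𝓕_{interior (D ∩ W)}`, the complement `Wᶜ` indexing `interior (D ∖ W)`.
Named facts (D-0014; statements only):
* `SchrammSmirnov2011_thm_1_7` — Thm. 1.7 in the (only non-trivial) direction
  `Borel(ℋ_D) ⊆ ∨_j 𝓕_{D_j}` mod `μ`, `D_j` the connected components of `D ∖ α`
  (the inclusions `∨_j 𝓕_{D_j} ≤ 𝓕_{D∖α} ≤ 𝓕_D = Borel` are tautological / Thm. 1.4 (2));
* `SchrammSmirnov2011_cor_1_8_noise` — Cor. 1.8, the noise (measure-factorization) property on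
  the rectangle base: for `W ∈ rectAlgebra`, `𝓕_{int(D ∩ W)}` and `𝓕_{int(D ∖ W)}` are independent
  under `μ` and together generate the Borel `σ`-algebra mod `μ`;
* `SchrammSmirnov2011_cor_1_8_black` — Cor. 1.8 "it has to be a black noise", in the form of
  Tsirelson 2014 Def. 1.2–1.3 on the rectangle base: every `f ∈ L²(μ)` with
  `f = E[f | 𝓕_{int(D ∩ W)}] + E[f | 𝓕_{int(D ∖ W)}]` a.e. for all `W ∈ rectAlgebra` (i.e. `f` in
  the first chaos) vanishes a.e.

## What is NOT vendored, and why

The route's intended "`Σ`-Var form" of blackness — `Σ_{cells C of b_n} Var(E[X | 𝓕_C]) → 0` for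
every `X ∈ L²(μ)` along an increasing sequence of finite subalgebras `b_n` (dyadic grids, or their
images under a conformal map) — is NOT a printed statement for the bond-`ℤ²` subsequential limits:
by Tsirelson 2014 §1.5 it is blackness of the subalgebra `B₀ = ∪ b_n`, which follows from
blackness of the full base `B` only when `B₀` is SUFFICIENT in `B` (`H⁽¹⁾(B₀) = H⁽¹⁾(B)`), e.g.
dense (Prop. 1.10) or atomless (Thm. 1.13, `inf_{x ∈ F} x = 0_Λ` for every ultrafilter `F` — for
grid subalgebras this is the triviality of the percolation `σ`-field at a point, a one-arm/RSW
statement), and `H⁽¹⁾(B₀) = ∩_n H⁽¹⁾(b_n)` makes `‖proj f‖² = lim_n Σ_C Var(E[f | 𝓕_C])`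
(Tsirelson 2003, Lemma 115 of arXiv:math/0301237: `𝐇₁(f) = ‖Q₁ f‖`, for one-dimensional
noises, the limit taken over ALL finite partitions ordered by inclusion).  That bridge is a
theorem to be proved (route support), not a citation; it is deliberately not asserted here.
Likewise not vendored: Tsirelson's abstract notions (noise-type Boolean algebra, completion,
sufficiency) as a general theory — only their instance on the rectangle base appears, inlined in
the two Cor. 1.8 facts; and the homogeneity/continuity clauses of "noise" (translation
invariance holds for `D = ℂ` only).

## Search

`lean search 'crossingField|IsNoise|BlackNoise|firstChaos|Tsirelson'`: nothing in Mathlib or the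
tree (only this topic's `quadCrossing…` files); Mathlib provides `ProbabilityTheory.Indep` for
sub-`σ`-algebras, `MeasureTheory.condExp` (`μ[f|m]`), `MemLp`, `BoundedVariationOn`,
`connectedComponentIn`, which are used as is.
-/

noncomputable section

open scoped Topology unitInterval
open Set Filter MeasureTheory ProbabilityTheory

namespace Literature.Probability.Percolation

namespace QuadCrossing

variable {D : Set ℂ}

/-! ### Sub-`σ`-algebras of crossing events inside a subdomain -/

/-- **`𝓕_U := σ(⊞_Q : [Q] ⊆ U)`**, the `σ`-algebra on `ℋ_D` generated by the crossing events of
the quads of `D` lying inside `U` (SS11 p. 11: "`𝓕_D := σ(⊞_Q, Q ∈ 𝒬_D)` … the corresponding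
subfield"; for a subdomain `U ⊆ D`, `𝒬_U = {Q : [Q] ⊆ U}`). [cite: SchrammSmirnov2011, §1.4 (before Thm. 1.7)] -/
abbrev crossingField (U : Set ℂ) : MeasurableSpace (QuadConfig D) :=
  MeasurableSpace.generateFrom {A | ∃ Q : Quad D, Q.carrier ⊆ U ∧ A = QuadConfig.crossedEvent Q}

/-- `𝓕_U` is a sub-`σ`-algebra of the Borel `σ`-algebra of `ℋ_D` (crossing events are closed).
[cite: SchrammSmirnov2011, §1.3] -/
theorem crossingField_le (U : Set ℂ) :
    crossingField (D := D) U ≤ (inferInstance : MeasurableSpace (QuadConfig D)) := by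
  refine MeasurableSpace.generateFrom_le ?_
  rintro _ ⟨Q, -, rfl⟩
  exact QuadConfig.measurableSet_crossedEvent Q

/-- `𝓕_U` is monotone in `U`. [folklore] -/
theorem crossingField_mono {U V : Set ℂ} (h : U ⊆ V) :
    crossingField (D := D) U ≤ crossingField (D := D) V :=
  MeasurableSpace.generateFrom_mono fun _ ⟨Q, hQ, hA⟩ => ⟨Q, hQ.trans h, hA⟩

/-- The crossing event of a quad inside `U` is `𝓕_U`-measurable. [cite: SchrammSmirnov2011, §1.4] -/
theorem measurableSet_crossingField_crossedEvent {U : Set ℂ} {Q : Quad D} (hQ : Q.carrier ⊆ U) :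
    MeasurableSet[crossingField U] (QuadConfig.crossedEvent Q) :=
  MeasurableSpace.measurableSet_generateFrom ⟨Q, hQ, rfl⟩

/-! ### Inclusion of `σ`-algebras up to null sets -/

section AE

variable {Ω : Type*}

/-- **`m₁ ⊆ m₂` up to sets of `μ`-measure zero**: every `m₁`-measurable set is `μ`-a.e. equal to
some `m₂`-measurable set (SS11 Thm. 1.7: "`𝓕_D = … = ∨_j 𝓕_{D_j}`, up to sets of measure
zero"; Tsirelson: `σ`-fields "contain all null sets").  As for Mathlib's `Indep`, the ambient
`σ`-algebra carrying `μ` is the implicit `mΩ`. [folklore] -/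
def AEIncluded {mΩ : MeasurableSpace Ω} (μ : Measure Ω) (m₁ m₂ : MeasurableSpace Ω) : Prop :=
  ∀ s : Set Ω, MeasurableSet[m₁] s → ∃ t : Set Ω, MeasurableSet[m₂] t ∧ s =ᵐ[μ] t

/-- A genuine inclusion is an inclusion up to null sets. [folklore] -/
theorem AEIncluded.of_le {m₁ m₂ mΩ : MeasurableSpace Ω} {μ : Measure Ω} (h : m₁ ≤ m₂) :
    AEIncluded μ m₁ m₂ :=
  fun s hs => ⟨s, h s hs, EventuallyEq.rfl⟩

/-- Reflexivity. [folklore] -/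
theorem AEIncluded.refl (m : MeasurableSpace Ω) {mΩ : MeasurableSpace Ω} (μ : Measure Ω) :
    AEIncluded μ m m :=
  AEIncluded.of_le le_rfl

/-- Transitivity. [folklore] -/
theorem AEIncluded.trans {m₁ m₂ m₃ mΩ : MeasurableSpace Ω} {μ : Measure Ω}
    (h₁ : AEIncluded μ m₁ m₂) (h₂ : AEIncluded μ m₂ m₃) : AEIncluded μ m₁ m₃ := by
  intro s hs
  obtain ⟨t, ht, hst⟩ := h₁ s hs
  obtain ⟨u, hu, htu⟩ := h₂ t ht
  exact ⟨u, hu, hst.trans htu⟩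

end AE

/-! ### Cuts: finite unions of finite-length paths -/

/-- `α ⊆ ℂ` is **a finite union of finite-length paths with finitely many double points**
(SS11 Thm. 1.7): `α = ⋃ᵢ γᵢ([0,1])` for finitely many continuous paths `γᵢ : [0,1] → ℂ` of bounded
variation (finite length), such that only finitely many points of `α` have two distinct
parameter preimages `(i, t) ≠ (i', t')` (self-intersections, mutual intersections and closing
points counted; in particular each `γᵢ` is injective off finitely many parameters).
[cite: SchrammSmirnov2011, Thm. 1.7 (hypothesis on α)] -/
def IsFiniteLengthPathUnion (α : Set ℂ) : Prop :=
  ∃ (n : ℕ) (γ : Fin n → C(I, ℂ)), α = ⋃ i, range (γ i) ∧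
    (∀ i, BoundedVariationOn (γ i) univ) ∧
    {z : ℂ | ∃ p q : Fin n × I, p ≠ q ∧ γ p.1 p.2 = z ∧ γ q.1 q.2 = z}.Finite

/-- The empty cut. [folklore] -/
theorem isFiniteLengthPathUnion_empty : IsFiniteLengthPathUnion (∅ : Set ℂ) := by
  refine ⟨0, fun i => i.elim0, by simp, fun i => i.elim0, ?_⟩
  convert Set.finite_empty
  ext z
  simp only [mem_setOf_eq, mem_empty_iff_false, iff_false, not_exists, not_and]
  intro p
  exact p.1.elim0

/-! ### The Boolean base generated by rectangles -/

/-- The open coordinate half-planes `{re < a}` and `{im < a}` of `ℂ`. [folklore] -/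
def halfPlanes : Set (Set ℂ) :=
  {W | ∃ a : ℝ, W = {z : ℂ | z.re < a}} ∪ {W | ∃ a : ℝ, W = {z : ℂ | z.im < a}}

/-- **The Boolean base "generated by rectangles"** (SS11 Cor. 1.8: "a Boolean base given by an
appropriate algebra of piecewise-smooth planar domains (e.g., generated by rectangles)"): the
Boolean algebra of subsets of `ℂ` generated by the coordinate half-planes (Mathlib
`MeasureTheory.generateSetAlgebra`: closed under complement, finite union and intersection) — its
elements are, up to finitely many coordinate lines, the finite unions of (possibly unbounded) open
axis-parallel rectangles, and it is closed under complementation, as a BOOLEAN base must be.  An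
element `W` stands for the planar domain `interior (D ∩ W)` of `D`; its complement `Wᶜ` for
`interior (D ∖ W)`; the two differ from a partition of `D` by `D ∩ ∂W`, a subset of finitely many
lines (a cut, negligible by Thm. 1.7). [cite: SchrammSmirnov2011, Cor. 1.8] -/
def rectAlgebra : Set (Set ℂ) :=
  MeasureTheory.generateSetAlgebra halfPlanes

/-- The rectangle base is a Boolean algebra of sets. [folklore] -/
theorem isSetAlgebra_rectAlgebra : MeasureTheory.IsSetAlgebra rectAlgebra :=
  MeasureTheory.isSetAlgebra_generateSetAlgebra

/-- The rectangle base is closed under complement (the complementary domain). [folklore] -/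
theorem compl_mem_rectAlgebra {W : Set ℂ} (hW : W ∈ rectAlgebra) : Wᶜ ∈ rectAlgebra :=
  isSetAlgebra_rectAlgebra.compl_mem hW

/-- The whole plane belongs to the base (non-vacuity; its domain is `D`, its complement's is
`∅`). [folklore] -/
theorem univ_mem_rectAlgebra : (univ : Set ℂ) ∈ rectAlgebra :=
  isSetAlgebra_rectAlgebra.univ_mem

/-- Open half-planes `{re < a}` belong to the base. [folklore] -/
theorem re_lt_mem_rectAlgebra (a : ℝ) : {z : ℂ | z.re < a} ∈ rectAlgebra :=
  MeasureTheory.self_subset_generateSetAlgebra (Or.inl ⟨a, rfl⟩)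

/-- Open half-planes `{im < a}` belong to the base. [folklore] -/
theorem im_lt_mem_rectAlgebra (a : ℝ) : {z : ℂ | z.im < a} ∈ rectAlgebra :=
  MeasureTheory.self_subset_generateSetAlgebra (Or.inr ⟨a, rfl⟩)

/-- **Rectangles belong to the base** (non-vacuity of "generated by rectangles"): the half-open
rectangle `[a, b) × [c, d)` is `{re < a}ᶜ ∩ {re < b} ∩ {im < c}ᶜ ∩ {im < d}`; its planar domain
`interior (D ∩ ·)` is `D ∩ (a, b) × (c, d)` for `D` open. [folklore] -/
theorem rect_mem_rectAlgebra (a b c d : ℝ) :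
    {z : ℂ | a ≤ z.re ∧ z.re < b ∧ c ≤ z.im ∧ z.im < d} ∈ rectAlgebra := by
  have h : {z : ℂ | a ≤ z.re ∧ z.re < b ∧ c ≤ z.im ∧ z.im < d} =
      {z : ℂ | z.re < a}ᶜ ∩ ({z : ℂ | z.re < b} ∩ ({z : ℂ | z.im < c}ᶜ ∩ {z : ℂ | z.im < d})) := by
    ext z
    simp [not_lt]
  rw [h]
  exact isSetAlgebra_rectAlgebra.inter_mem (compl_mem_rectAlgebra (re_lt_mem_rectAlgebra a))
    (isSetAlgebra_rectAlgebra.inter_mem (re_lt_mem_rectAlgebra b)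
      (isSetAlgebra_rectAlgebra.inter_mem (compl_mem_rectAlgebra (im_lt_mem_rectAlgebra c))
        (im_lt_mem_rectAlgebra d)))

/-- The **planar domain of `D` indexed by `W`**: `interior (D ∩ W)`; the `σ`-field attached to `W`
is `𝓕_{interior (D ∩ W)}` (`crossingField`). [cite: SchrammSmirnov2011, Cor. 1.8] -/
abbrev regionField (D : Set ℂ) (W : Set ℂ) : MeasurableSpace (QuadConfig D) :=
  crossingField (interior (D ∩ W))

/-- The complementary domain is indexed by the complement: `interior (D ∩ Wᶜ) = interior (D ∖ W)`.
[folklore] -/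
theorem regionField_compl (D W : Set ℂ) :
    regionField D Wᶜ = crossingField (D := D) (interior (D \ W)) := by
  rw [regionField, Set.sdiff_eq]

/-! ### The named facts -/

/-- NAMED FACT — **Schramm–Smirnov 2011, Theorem 1.7 (Factorization)**, for critical bond
percolation on `ℤ²` (a model satisfying Assumptions 1.1): "Let `D` be a domain, and let `α ⊂ ℂ`
be a finite union of finite length paths with finitely many double points.  Denote the components
of `D ∖ α` by `D_j`.  Then for any subsequential scaling limit `𝓕_D = 𝓕_{D∖α} = ∨_j 𝓕_{D_j}`, up to
sets of measure zero."  Rendered in its only non-tautological direction: for `D` open connected,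
`μ` a subsequential scaling limit in `ℋ_D` (`IsSubseqQuadLimit`) and `α` a cut, every Borel set
of `ℋ_D` (`= 𝓕_D`, Thm. 1.4 (2)) is `μ`-a.e. equal to a set measurable for
`∨_{x ∈ D∖α} 𝓕_{C(x)}`, `C(x)` the connected component of `x` in `D ∖ α`
(`⊔` of the `crossingField`s; `∨_j 𝓕_{D_j} ≤ 𝓕_{D∖α} ≤ 𝓕_D` holds by monotonicity).  Users take
`(h : SchrammSmirnov2011_thm_1_7)`. [cite: SchrammSmirnov2011, Thm. 1.7] -/
def SchrammSmirnov2011_thm_1_7 : Prop :=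
  ∀ (D : Set ℂ), IsOpen D → IsConnected D →
    ∀ μ : FiniteMeasure (QuadConfig D), IsSubseqQuadLimit D μ →
      ∀ α : Set ℂ, IsFiniteLengthPathUnion α →
        AEIncluded (μ : Measure (QuadConfig D)) (inferInstance : MeasurableSpace (QuadConfig D))
          (⨆ x ∈ D \ α, crossingField (connectedComponentIn (D \ α) x))

/-- NAMED FACT — **Schramm–Smirnov 2011, Corollary 1.8 (Percolation is a noise), the
measure-factorization property on the rectangle base.**  "Any subsequential scaling limit as
above is a noise with a Boolean base given by an appropriate algebra of piecewise-smooth planar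
domains (e.g., generated by rectangles)" — i.e. (Tsirelson 2014 §1.6, quoted in the module
docstring) `W ↦ 𝓕_{interior(D ∩ W)}` is a measure factorization over that base: the `σ`-fields of
an element and of its complement are INDEPENDENT and GENERATE everything.  Rendered for critical
bond percolation on `ℤ²`, `D` open connected, `μ` a subsequential scaling limit in `ℋ_D`, and
every `W ∈ rectAlgebra` (domains `interior (D ∩ W)` and `interior (D ∖ W)`): the two region
`σ`-fields are independent under `μ` (Mathlib `ProbabilityTheory.Indep` of sub-`σ`-algebras), and
the Borel `σ`-algebra is included in their join up to `μ`-null sets (Thm. 1.7 with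
`α ⊇ D ∩ ∂W` finitely many lines, restricted to a box).  The homogeneity (translation invariance,
for `D = ℂ`) and continuity clauses of "noise" are not part of this statement.
[cite: SchrammSmirnov2011, Cor. 1.8] -/
def SchrammSmirnov2011_cor_1_8_noise : Prop :=
  ∀ (D : Set ℂ), IsOpen D → IsConnected D →
    ∀ μ : FiniteMeasure (QuadConfig D), IsSubseqQuadLimit D μ →
      ∀ W ∈ rectAlgebra,
        Indep (regionField D W) (regionField D Wᶜ) (μ : Measure (QuadConfig D)) ∧
          AEIncluded (μ : Measure (QuadConfig D)) (inferInstance : MeasurableSpace (QuadConfig D))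
            (regionField D W ⊔ regionField D Wᶜ)

/-- NAMED FACT — **Schramm–Smirnov 2011, Corollary 1.8: the noise of a subsequential scaling
limit of critical bond percolation on `ℤ²` is BLACK** ("Therefore, it has to be a black noise, as
explained in [Ts03], Remark 8a2" — stated in the source by reference to Tsirelson's pivotal-cell
argument), in the form of Tsirelson 2014, Def. 1.2–1.3 on the rectangle base: the first chaos
space `H⁽¹⁾(B) = {f ∈ L²(μ) : f = E(f | x) + E(f | x') for all x ∈ B}`, `B` the image of the base,
is `{0}`.  Rendered: for `D` open connected and `μ` a subsequential scaling limit in `ℋ_D`, every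
real `f ∈ L²(μ)` such that `f = μ[f | 𝓕_{int(D ∩ W)}] + μ[f | 𝓕_{int(D ∖ W)}]` `μ`-a.e. for every
`W ∈ rectAlgebra` vanishes `μ`-a.e.  (Mathlib `condExp`; conditional expectations with respect to
a `σ`-field and to its augmentation by null sets agree a.e., so the source's completed `σ`-fields
are not needed; the base IS closed under complement, so every pair `(x, x')` of Def. 1.2 occurs.)
NOT included (see the module docstring): the "`Σ`-Var" form along dyadic / curvilinear grids,
which needs the sufficiency of the grid subalgebra (Tsirelson 2014 §1.5, Thm. 1.13).
[cite: SchrammSmirnov2011, Cor. 1.8 (blackness; first chaos as in Tsirelson2014 Def. 1.2–1.3)] -/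
def SchrammSmirnov2011_cor_1_8_black : Prop :=
  ∀ (D : Set ℂ), IsOpen D → IsConnected D →
    ∀ μ : FiniteMeasure (QuadConfig D), IsSubseqQuadLimit D μ →
      ∀ f : QuadConfig D → ℝ, MemLp f 2 (μ : Measure (QuadConfig D)) →
        (∀ W ∈ rectAlgebra,
          f =ᵐ[(μ : Measure (QuadConfig D))]
            (μ : Measure (QuadConfig D))[f | regionField D W] +
              (μ : Measure (QuadConfig D))[f | regionField D Wᶜ]) →
        f =ᵐ[(μ : Measure (QuadConfig D))] 0

/-! ### Elementary consequences (proved) -/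

/-- Under the factorization theorem, cutting along the empty cut changes nothing: a sanity
instance (`α = ∅`, one "component" family indexed by the points of `D`). [cite: SchrammSmirnov2011, Thm. 1.7] -/
theorem SchrammSmirnov2011_thm_1_7.empty_cut (h : SchrammSmirnov2011_thm_1_7) (hD : IsOpen D)
    (hD' : IsConnected D) {μ : FiniteMeasure (QuadConfig D)} (hμ : IsSubseqQuadLimit D μ) :
    AEIncluded (μ : Measure (QuadConfig D)) (inferInstance : MeasurableSpace (QuadConfig D))
      (⨆ x ∈ D, crossingField (connectedComponentIn D x)) := by
  simpa using h D hD hD' μ hμ ∅ isFiniteLengthPathUnion_empty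

/-- For `D` open, the domain indexed by the whole plane is `D` itself. [folklore] -/
theorem regionField_univ (hD : IsOpen D) : regionField D univ = crossingField (D := D) D := by
  rw [regionField, inter_univ, hD.interior_eq]

/-- The domain indexed by `∅` carries the trivial `σ`-field: no quad lies in `∅`. [folklore] -/
theorem regionField_compl_univ (D : Set ℂ) :
    regionField D univᶜ = (⊥ : MeasurableSpace (QuadConfig D)) := by
  rw [regionField, compl_univ, inter_empty, interior_empty, crossingField]
  refine le_antisymm (MeasurableSpace.generateFrom_le ?_) bot_le
  rintro _ ⟨Q, hQ, rfl⟩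
  exact absurd (hQ ⟨((0 : I), (0 : I)), rfl⟩) (notMem_empty _)

/-- Under Cor. 1.8 (noise part), the crossing field `𝓕_D` carries every Borel set up to null sets
(`W = ℂ`: `𝓕_D ∨ 𝓕_∅ = 𝓕_D`) — the a.e. form of "`𝓕_D = σ(⊞_Q, Q ∈ 𝒬_D)` is the Borel
`σ`-field" (Thm. 1.4 (2)). [cite: SchrammSmirnov2011, Cor. 1.8 and Thm. 1.4 (2)] -/
theorem SchrammSmirnov2011_cor_1_8_noise.borel_aeIncluded_crossingField
    (h : SchrammSmirnov2011_cor_1_8_noise) (hD : IsOpen D) (hD' : IsConnected D)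
    {μ : FiniteMeasure (QuadConfig D)} (hμ : IsSubseqQuadLimit D μ) :
    AEIncluded (μ : Measure (QuadConfig D)) (inferInstance : MeasurableSpace (QuadConfig D))
      (crossingField D) := by
  have h2 := (h D hD hD' μ hμ univ univ_mem_rectAlgebra).2
  rw [regionField_univ hD, regionField_compl_univ, sup_bot_eq] at h2
  exact h2

/-- The zero function satisfies the first-chaos identities of Cor. 1.8 (black part): non-vacuity
of the hypothesis class (`0 ∈ H⁽¹⁾`). [cite: Tsirelson2014, Def. 1.2] -/
theorem SchrammSmirnov2011_cor_1_8_black.zero_mem_firstChaos (μ : FiniteMeasure (QuadConfig D)) :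
    ∀ W ∈ rectAlgebra,
      (0 : QuadConfig D → ℝ) =ᵐ[(μ : Measure (QuadConfig D))]
        (μ : Measure (QuadConfig D))[(0 : QuadConfig D → ℝ) | regionField D W] +
          (μ : Measure (QuadConfig D))[(0 : QuadConfig D → ℝ) | regionField D Wᶜ] := by
  intro W _
  simp only [condExp_zero, add_zero]
  exact EventuallyEq.rfl

end QuadCrossing

end Literature.Probability.Percolation

end
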